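import Summits.HubbardSuperconductivity.HubbardSuperconductivity.Theorems.AnisotropyChordTransferFibre3LemmaVTargets
import Summits.HubbardSuperconductivity.HubbardSuperconductivity.Theorems.AnisotropyChordTransferFibre3ParsevalSplit

/-!
# Route `AnisotropyChord` / H0 rotor rung: PartN36 — the MOMENTUM COUNT `PoleCount` of LEMMA V′ PROVED (every `L`)

Theory seat `hubbard-h0-rotor-theory-1` g21, memo ROTOR-THEORY-21 §313(c), typed target `PoleCount`
(`…Fibre3LemmaVTargets`, PORT PartN36): for `ψ` orthogonal to the three pole waves,
`‖Π₁⁰ψ‖² + ‖Π₂⁰ψ‖² + ‖Π₃⁰ψ‖² ≤ ‖ψ‖²` — at most one particle is at rest.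

Proof (pure Fourier analysis on `(ℤ/L)²×(ℤ/L)²`, no hard core, no symmetry):
* `parseval1D`: `Σ_q ‖Σ_b conj φ_q(b)·G b‖² = V·Σ_b ‖G b‖²` (`V = L²`);
* the three weights are partial Plancherel sums of the fibre Fourier coefficients `fcoef ψ`:
  `restSq2 = V⁻² Σ_q |ψ̂(0,q)|²`, `restSq3 = V⁻² Σ_q |ψ̂(q,0)|²`, `restSq1 = V⁻² Σ_q |ψ̂(q,K₁−q)|²`
  (`fcoef_zero_left/right`, `fcoef_diag`);
* pointwise on `k = (k₂,k₃)`: `[k₃ = K₁−k₂] + [k₂ = 0] + [k₃ = 0] ≤ 1` unless `k` is a pole, where `ψ̂(k) = 0`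
  (`fcoef_pole_eq_zero`), and Plancherel `re_ip_self_fourier`.
Prover seat `hubbard-h0-rotor-p1` g23; helper for stmt-HubbardSuperconductivity-19089 (`--supports`).
-/

set_option linter.dupNamespace false
set_option autoImplicit false

noncomputable section

open scoped BigOperators
open Complex

namespace Summit.HubbardSuperconductivity.HubbardSuperconductivity.Theorems.AnisotropyChord.Transfer.Fibre3

variable (L : ℕ) [NeZero L]

/-! ## One-dimensional Parseval on the torus -/

/-- **1D Parseval on `(ℤ/L)²`:** `Σ_q ‖Σ_b conj φ_q(b)·G(b)‖² = L²·Σ_b ‖G b‖²`. [folklore] -/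
theorem parseval1D (G : Tor L → ℂ) :
    ∑ q : Tor L, ‖∑ b : Tor L, (starRingEnd ℂ) (phase L q b) * G b‖ ^ 2 = (L : ℝ) ^ 2 * ∑ b : Tor L, ‖G b‖ ^ 2 := by
  apply Complex.ofReal_injective
  push_cast
  have hX : ∀ q : Tor L, ((‖∑ b : Tor L, (starRingEnd ℂ) (phase L q b) * G b‖ : ℂ) ^ 2)
      = ∑ b : Tor L, ∑ b' : Tor L, (starRingEnd ℂ) (G b) * G b' * phase L q (b - b') := by
    intro q
    rw [← Complex.conj_mul', map_sum, Finset.sum_mul_sum]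
    refine Finset.sum_congr rfl fun b _ => Finset.sum_congr rfl fun b' _ => ?_
    rw [map_mul, Complex.conj_conj, conj_phase, sub_eq_add_neg, phase_add]
    ring
  rw [Finset.sum_congr rfl fun q _ => hX q, Finset.sum_comm, Finset.mul_sum]
  refine Finset.sum_congr rfl fun b _ => ?_
  rw [Finset.sum_comm]
  have hq : ∀ b' : Tor L, ∑ q : Tor L, (starRingEnd ℂ) (G b) * G b' * phase L q (b - b')
      = if b = b' then (starRingEnd ℂ) (G b) * G b' * (L : ℂ) ^ 2 else 0 := by
    intro b'
    rw [← Finset.mul_sum, sum_phase_left]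
    by_cases h : b = b'
    · simp [h]
    · have h' : b - b' ≠ 0 := sub_ne_zero.mpr h
      simp [h, h']
  rw [Finset.sum_congr rfl fun b' _ => hq b', Finset.sum_ite_eq]
  simp only [Finset.mem_univ, if_true]
  rw [← Complex.conj_mul']
  ring

/-! ## The three «at rest» weights as partial Plancherel sums -/

/-- `ψ̂(0,q) = Σ_b conj φ_q(b) · (Σ_a ψ(a,b))`. [folklore] -/
theorem fcoef_zero_left (ψ : Cfg L → ℂ) (q : Tor L) :
    fcoef L ψ (0, q) = ∑ b : Tor L, (starRingEnd ℂ) (phase L q b) * ∑ a : Tor L, ψ (a, b) := by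
  unfold fcoef ip pw
  simp only [phase_zero_left, one_mul]
  rw [Fintype.sum_prod_type, Finset.sum_comm]
  simp_rw [Finset.mul_sum]

/-- `ψ̂(q,0) = Σ_a conj φ_q(a) · (Σ_b ψ(a,b))`. [folklore] -/
theorem fcoef_zero_right (ψ : Cfg L → ℂ) (q : Tor L) :
    fcoef L ψ (q, 0) = ∑ a : Tor L, (starRingEnd ℂ) (phase L q a) * ∑ b : Tor L, ψ (a, b) := by
  unfold fcoef ip pw
  simp only [phase_zero_left, mul_one]
  rw [Fintype.sum_prod_type]
  simp_rw [Finset.mul_sum]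

/-- `ψ̂(q, K₁−q) = Σ_d conj φ_q(d) · (Σ_b conj φ_{K₁}(b) ψ(b+d, b))` (particle 1 at rest ⟺ `k₂ + k₃ = K₁`). [folklore] -/
theorem fcoef_diag (ψ : Cfg L → ℂ) (q : Tor L) :
    fcoef L ψ (q, K1 L - q)
      = ∑ d : Tor L, (starRingEnd ℂ) (phase L q d) * ∑ b : Tor L, (starRingEnd ℂ) (phase L (K1 L) b) * ψ (b + d, b) := by
  unfold fcoef ip pw
  simp only
  rw [Fintype.sum_prod_type]
  simp_rw [Finset.mul_sum]
  rw [Finset.sum_comm]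
  conv_rhs => rw [Finset.sum_comm]
  refine Finset.sum_congr rfl fun b _ => ?_
  -- reindex `a = d + b`
  rw [← Fintype.sum_equiv (Equiv.addRight b)
    (fun d => (starRingEnd ℂ) (phase L q d) * ((starRingEnd ℂ) (phase L (K1 L) b) * ψ (b + d, b)))
    (fun a => (starRingEnd ℂ) (phase L q a * phase L (K1 L - q) b) * ψ (a, b)) ?_]
  intro d
  simp only [Equiv.coe_addRight]
  rw [phase_add, ← phase_sub_left_mul L (K1 L) q b, map_mul, map_mul, map_mul, add_comm d b]
  ring

/-- `restSq2 ψ = V⁻² Σ_q |ψ̂(0,q)|²`. [folklore] -/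
theorem restSq2_eq (ψ : Cfg L → ℂ) :
    restSq2 L ψ = (∑ q : Tor L, ‖fcoef L ψ (0, q)‖ ^ 2) / ((L : ℝ) ^ 2) ^ 2 := by
  have hL : (L : ℝ) ≠ 0 := Nat.cast_ne_zero.mpr (NeZero.ne L)
  unfold restSq2
  simp_rw [fcoef_zero_left, parseval1D]
  field_simp

/-- `restSq3 ψ = V⁻² Σ_q |ψ̂(q,0)|²`. [folklore] -/
theorem restSq3_eq (ψ : Cfg L → ℂ) :
    restSq3 L ψ = (∑ q : Tor L, ‖fcoef L ψ (q, 0)‖ ^ 2) / ((L : ℝ) ^ 2) ^ 2 := by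
  have hL : (L : ℝ) ≠ 0 := Nat.cast_ne_zero.mpr (NeZero.ne L)
  unfold restSq3
  simp_rw [fcoef_zero_right, parseval1D]
  field_simp

/-- `restSq1 ψ = V⁻² Σ_q |ψ̂(q,K₁−q)|²`. [folklore] -/
theorem restSq1_eq (ψ : Cfg L → ℂ) :
    restSq1 L ψ = (∑ q : Tor L, ‖fcoef L ψ (q, K1 L - q)‖ ^ 2) / ((L : ℝ) ^ 2) ^ 2 := by
  have hL : (L : ℝ) ≠ 0 := Nat.cast_ne_zero.mpr (NeZero.ne L)
  unfold restSq1
  simp_rw [fcoef_diag, parseval1D]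
  field_simp

/-! ## The momentum count -/

omit [NeZero L] in
/-- **pointwise momentum count:** with `w ≥ 0` vanishing on the three poles,
`[k₃ = K₁ − k₂]·w + [k₂ = 0]·w + [k₃ = 0]·w ≤ w`. [folklore] -/
theorem pole_count_pointwise (w : Tor L × Tor L → ℝ) (hw : ∀ k, 0 ≤ w k)
    (hp : ∀ k, IsPoleK1 L k.1 k.2 = true → w k = 0) (k₂ k₃ : Tor L) :
    (if k₃ = K1 L - k₂ then w (k₂, k₃) else 0) + (if k₂ = 0 then w (k₂, k₃) else 0)
      + (if k₃ = 0 then w (k₂, k₃) else 0) ≤ w (k₂, k₃) := by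
  have h0 := hw (k₂, k₃)
  by_cases h2 : k₂ = 0
  · subst h2
    by_cases h3 : k₃ = 0
    · subst h3
      have : w (0, 0) = 0 := hp (0, 0) ((isPoleK1_iff L (0, 0)).2 (Or.inl rfl))
      simp [this]
    · by_cases h3' : k₃ = K1 L
      · subst h3'
        have : w (0, K1 L) = 0 := hp (0, K1 L) ((isPoleK1_iff L (0, K1 L)).2 (Or.inr (Or.inr rfl)))
        simp [this]
      · have h3'' : ¬ (k₃ = K1 L - 0) := by rw [sub_zero]; exact h3'
        rw [if_neg h3'', if_pos rfl, if_neg h3]; linarith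
  · rw [if_neg h2]
    by_cases h3 : k₃ = 0
    · subst h3
      by_cases h1 : k₂ = K1 L
      · subst h1
        have : w (K1 L, 0) = 0 := hp (K1 L, 0) ((isPoleK1_iff L (K1 L, 0)).2 (Or.inr (Or.inl rfl)))
        simp [this]
      · have h1' : ¬ ((0 : Tor L) = K1 L - k₂) := fun h => h1 (by rw [eq_sub_iff_add_eq, zero_add] at h; exact h)
        rw [if_neg h1', if_pos rfl]; linarith
    · rw [if_neg h3]
      by_cases h1 : k₃ = K1 L - k₂
      · rw [if_pos h1]; linarith
      · rw [if_neg h1]; linarith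

/-- **the momentum count of Fourier coefficients:** for `ψ ⟂` the three pole waves,
`Σ_q |ψ̂(q,K₁−q)|² + Σ_q |ψ̂(0,q)|² + Σ_q |ψ̂(q,0)|² ≤ Σ_k |ψ̂(k)|²`. [folklore] -/
theorem pole_count_fourier {ψ : Cfg L → ℂ} (hψ : ∀ j : Fin 3, ip L (poleWave L j) ψ = 0) :
    (∑ q : Tor L, ‖fcoef L ψ (q, K1 L - q)‖ ^ 2) + (∑ q : Tor L, ‖fcoef L ψ (0, q)‖ ^ 2)
      + (∑ q : Tor L, ‖fcoef L ψ (q, 0)‖ ^ 2) ≤ ∑ k : Tor L × Tor L, ‖fcoef L ψ k‖ ^ 2 := by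
  set w : Tor L × Tor L → ℝ := fun k => ‖fcoef L ψ k‖ ^ 2 with hwdef
  have hw : ∀ k, 0 ≤ w k := fun k => sq_nonneg _
  have hp : ∀ k, IsPoleK1 L k.1 k.2 = true → w k = 0 := fun k hk => by
    simp only [hwdef, fcoef_pole_eq_zero L hψ hk, norm_zero]; ring
  -- the three line sums as indicator sums over all `k = (k₂,k₃)`
  have e1 : ∑ q : Tor L, w (q, K1 L - q) = ∑ k₂ : Tor L, ∑ k₃ : Tor L, (if k₃ = K1 L - k₂ then w (k₂, k₃) else 0) := by
    refine Finset.sum_congr rfl fun k₂ _ => ?_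
    rw [Finset.sum_ite_eq' Finset.univ (K1 L - k₂)]; simp
  have e2 : ∑ q : Tor L, w (0, q) = ∑ k₂ : Tor L, ∑ k₃ : Tor L, (if k₂ = 0 then w (k₂, k₃) else 0) := by
    rw [Finset.sum_comm]
    refine Finset.sum_congr rfl fun k₃ _ => ?_
    rw [Finset.sum_ite_eq' Finset.univ (0 : Tor L)]; simp
  have e3 : ∑ q : Tor L, w (q, 0) = ∑ k₂ : Tor L, ∑ k₃ : Tor L, (if k₃ = 0 then w (k₂, k₃) else 0) := by
    refine Finset.sum_congr rfl fun k₂ _ => ?_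
    rw [Finset.sum_ite_eq' Finset.univ (0 : Tor L)]; simp
  have etot : ∑ k : Tor L × Tor L, w k = ∑ k₂ : Tor L, ∑ k₃ : Tor L, w (k₂, k₃) := Fintype.sum_prod_type _
  show (∑ q : Tor L, w (q, K1 L - q)) + (∑ q : Tor L, w (0, q)) + (∑ q : Tor L, w (q, 0)) ≤ ∑ k : Tor L × Tor L, w k
  rw [e1, e2, e3, etot, ← Finset.sum_add_distrib, ← Finset.sum_add_distrib]
  refine Finset.sum_le_sum fun k₂ _ => ?_
  rw [← Finset.sum_add_distrib, ← Finset.sum_add_distrib]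
  refine Finset.sum_le_sum fun k₃ _ => ?_
  exact pole_count_pointwise L w hw hp k₂ k₃

/-- **`PoleCount` holds (every `L`):** `ψ ⟂ p₀,p₁,p₂ ⇒ ‖Π₁⁰ψ‖² + ‖Π₂⁰ψ‖² + ‖Π₃⁰ψ‖² ≤ ‖ψ‖²`. [folklore] -/
theorem poleCount_holds : PoleCount L := by
  intro ψ hψ
  rw [restSq1_eq, restSq2_eq, restSq3_eq, re_ip_self_fourier, ← add_div, ← add_div]
  have h := pole_count_fourier L hψ
  have hV : (0 : ℝ) ≤ ((L : ℝ) ^ 2) ^ 2 := by positivity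
  calc _ ≤ (∑ k : Tor L × Tor L, ‖fcoef L ψ k‖ ^ 2) / ((L : ℝ) ^ 2) ^ 2 := div_le_div_of_nonneg_right h hV
    _ = _ := by ring

end Summit.HubbardSuperconductivity.HubbardSuperconductivity.Theorems.AnisotropyChord.Transfer.Fibre3

end
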